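import Literature.AlgebraicGeometry.Resolution.AffineModelLU
import HarnessLib

/-!
# (LU) holds for regular local domains

Topic: `Literature/AlgebraicGeometry/Resolution`. A PROVED step of Cossart–Piltant's reduction
of (LU) to the local theorem (Cossart–Piltant 2019, proof of journal Prop. 4.10 = arXiv v1
Prop. 4.8, v1 p. 54): "Note that `(LU v₀)` holds by construction since `S` is regular" — the
base case of the chain `(LU v₀) ⇒ (LU v₀ⁱ) ⇒ (LU v₀ʳ) ⇒ (LU vʳ) ⇒ (LU vⁱ) ⇒ (LU v)`: a
regular local domain `S` is its own local uniformization along every valuation ring of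
`Frac S` dominating it, with `T := S = S[∅]` and `T_{m_v ∩ T} = S`.

## Content (namespace `Literature.AlgGeom`)

* `cpLocalUniformization_of_isRegularLocalRing` — `CPLocalUniformization S` for every regular
  local domain `S` (`CPLocalUniformization` is CP's property (LU) of §4.1, file
  `ArithmeticalThreefolds.lean`).

[cite: CossartPiltant2019, proof of Prop. 4.10 (arXiv v1: Prop. 4.8), "(LU v₀) holds since S is
regular"]
-/

noncomputable section

open IsLocalRing

namespace Literature.AlgebraicGeometry.Resolution

universe u

/-- **`(LU v₀)` for a regular local domain** (Cossart–Piltant 2019, proof of journal Prop. 4.10 =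
arXiv v1 Prop. 4.8: "Note that `(LU v₀)` holds by construction since `S` is regular"): if `S` is
a regular local domain then every valuation ring `𝒪_v` of `Frac S` containing `S` and centred
in `m_S` is uniformized by `T := S[∅] = S` itself: `m_v ∩ T = m_S` and `T_{m_S} = S` is regular.
[cite: CossartPiltant2019, proof of Prop. 4.10 (arXiv v1: Prop. 4.8)] -/
theorem cpLocalUniformization_of_isRegularLocalRing (S : Type u) [CommRing S] [IsDomain S]
    [IsRegularLocalRing S] : CPLocalUniformization S := by
  classical
  intro K _ _ _ O hSO hdom _
  have hTO : (Algebra.adjoin S ((∅ : Finset K) : Set K)).toSubring ≤ O.toSubring := by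
    intro x hx
    simp only [Finset.coe_empty, Algebra.adjoin_empty, Subalgebra.mem_toSubring] at hx
    obtain ⟨c, rfl⟩ := Algebra.mem_bot.mp hx
    exact hSO c
  refine ⟨∅, hTO, ?_⟩
  set T : Subring K := (Algebra.adjoin S ((∅ : Finset K) : Set K)).toSubring with hTdef
  set P : Ideal T := Ideal.comap (Subring.inclusion hTO) (maximalIdeal O) with hPdef
  -- `S ≃ T = S[∅]` via the (injective) structure map `S → K`
  have hmemT : ∀ a : S, algebraMap S K a ∈ T := fun a => by
    simp only [hTdef, Subalgebra.mem_toSubring, Finset.coe_empty, Algebra.adjoin_empty]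
    exact Algebra.mem_bot.mpr ⟨a, rfl⟩
  let f : S →+* T := (algebraMap S K).codRestrict T hmemT
  have hf : ∀ a, ((f a : T) : K) = algebraMap S K a := fun _ => rfl
  have hfinj : Function.Injective f := fun a b h =>
    IsFractionRing.injective S K (by rw [← hf a, ← hf b, h])
  have hfsurj : Function.Surjective f := fun y => by
    have hy : (y : K) ∈ Algebra.adjoin S ((∅ : Finset K) : Set K) := y.2
    simp only [Finset.coe_empty, Algebra.adjoin_empty] at hy
    obtain ⟨c, hc⟩ := Algebra.mem_bot.mp hy
    exact ⟨c, Subtype.ext hc⟩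
  let e : S ≃+* T := RingEquiv.ofBijective f ⟨hfinj, hfsurj⟩
  have he : ∀ a, ((e a : T) : K) = algebraMap S K a := fun _ => rfl
  -- the centre `P = m_v ∩ T` corresponds to `m_S`
  have hPmem : ∀ a : S, e a ∈ P ↔ a ∈ maximalIdeal S := by
    intro a
    rw [hPdef, Ideal.mem_comap, ValuationSubring.valuation_lt_one_iff]
    change O.valuation (algebraMap S K a) < 1 ↔ _
    constructor
    · intro hlt
      by_contra hna
      have hu : IsUnit a := by
        by_contra hnu
        exact hna ((IsLocalRing.mem_maximalIdeal a).mpr hnu)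
      obtain ⟨b, hb⟩ := hu.exists_right_inv
      have h1 : O.valuation (algebraMap S K a) = 1 :=
        valuation_eq_one_of_mul_eq_one O (hSO a) (hSO b) (by rw [← map_mul, hb, map_one])
      exact (lt_irrefl _) (h1 ▸ hlt)
    · exact hdom a
  -- every element of `T` outside `P` is a unit of `T`, so `T_P = T ≅ S`
  have hunits : P.primeCompl ≤ IsUnit.submonoid T := by
    intro y hy
    obtain ⟨a, rfl⟩ := e.surjective y
    have ha : a ∉ maximalIdeal S := fun h => hy ((hPmem a).mpr h)
    have hu : IsUnit a := by
      by_contra hnu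
      exact ha ((IsLocalRing.mem_maximalIdeal a).mpr hnu)
    exact hu.map e
  haveI : IsLocalization P.primeCompl T := IsLocalization.self hunits
  let g : T ≃ₐ[T] Localization.AtPrime P :=
    IsLocalization.algEquiv P.primeCompl T (Localization.AtPrime P)
  haveI : IsRegularLocalRing T := IsRegularLocalRing.of_ringEquiv e
  exact IsRegularLocalRing.of_ringEquiv g.toRingEquiv

end Literature.AlgebraicGeometry.Resolution

end
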